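import Literature.NumberTheory.EllipticCurves.PAdicOneVariableSeriesFamilyOfRelNormCoherentUnits
import Literature.NumberTheory.NumberFields.RayClassFieldAdicCharacterLocalUnits
import Literature.NumberTheory.NumberFields.RayClassFieldAdicCharacterTower
import HarnessLib

/-!
# `p = 2`, CM assembly at the split prime `v`: the hypothesis `hη`/`hgal` of the RELATIVE series family from a
# Galois DICTIONARY keyed on `κ_v`, and the inversion-invariance of the cell hypotheses `hU`/`hκ`
# (de Shalit II.1.10 Cor., II.4.5–4.6: `Gal(K(𝔣𝔭^∞)/K(𝔣))` acts on the `𝔓`-adic units through the local inertia)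

Topic `NumberTheory/EllipticCurves`; namespace `Literature.NumberTheory.EllipticCurves`.

The series-family instantiation for the relative units (`PAdicOneVariableSeriesFamilyOfRelNormCoherentUnits.lean`) needs

  `hη : ∀ g ∈ U_0, ∀ b, ∃ σ̃ ∈ Γ_{K_v}, (σ̃ fixes E) ∧ η (g • b) = (η b).galAct σ̃ ∧ e(χ_π σ̃) = κ g`

for the GLOBAL group `G = Gal(K̄/K(𝔪))` acting on the semi-local units `B`.  With the decomposition-group supply
(`RayClassFieldAdicCharacterDecomposition.lean`: for every `g` an inertia element `w` with `κ_v(res w) = κ_v g`, acting like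
`g` on every `K(𝔪vⁿ)`), the inertia/unramified lemma and the units-level junction (`RayClassFieldAdicCharacterLocalUnits.lean`:
`w` fixes `E`, `e(χ_π w) = ((e ∘ §1⁻¹)(κ_v g))⁻¹`), `hη` REDUCES to the purely Galois-theoretic DICTIONARY

  `hdict : ∀ g ∈ U_0, ∀ b, ∀ w ∈ I_{K_v}, κ_v(res w) = κ_v g → η (g • b) = (η b).galAct (toAbsGalois w)`

(«`g` acts on the `𝔓`-component of `b` as any local inertia element with the same `κ_v`» — de Shalit II.1.10 Corollary /
II.4.5: the `𝔭`-division tower is the image of the local inertia), for the character **`κ := ((e ∘ §1⁻¹) ∘ κ_v)⁻¹`**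
(pointwise inverse — the tree's `κ_v` is the inverse of the Lubin–Tate character under `res`):

* ★ `seriesFamily_hη_of_dictionary` — `hdict ⟹ hη`; ★ `seriesFamily_hgal_of_dictionary` — `hdict ⟹ hgal` VERBATIM
  (through `seriesFamily_hgal_of_relNormCoherentUnits`);
* `toZModPow_units_inv_eq_one_iff`, ★ `subgroupTower_hU_inv`, ★ `subgroupTower_hκ_inv` — the cell hypotheses `hU`/`hκ` of
  the series-family files for `κ⁻¹` from those for `κ`; instantiated on the GLOBAL ray tower: ★ `mem_rayAdicTower_iff_inv`,
  ★ `exists_toZModPow_padicRayAdicCharacter_inv_eq` (`hU`/`hκ` VERBATIM for `(rayAdicTower, κ_p⁻¹)`, from g8's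
  `mem_rayAdicTower_iff` / `exists_toZModPow_padicRayAdicCharacter_eq`) and `padicRayAdicCharacter_inv_apply` (the `hκ`
  identity `κ_p⁻¹ g = ((e ∘ §1⁻¹)(κ_v g))⁻¹` for `e := e₂ ∘ §1`).

Theorems only; no named facts, no definitions, no instances (section-local instance attributes as in the siblings), no `sorry`.

## References

* [deShalit1987] E. de Shalit, *Iwasawa theory of elliptic curves with complex multiplication* (1987),
  I.3.3 (9) (p. 18), I.3.4 Lemma (ii) (p. 18), II.1.7 (p. 41), II.1.10 Corollary (p. 39), II.4.5–4.6 (p. 58–59).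
-/

noncomputable section

open MvPowerSeries

namespace Literature.NumberTheory.EllipticCurves

/-! ### §1. `hU` / `hκ` are inversion-invariant -/

section Inversion

variable {p : ℕ} [Fact p.Prime] {G : Type*} [Group G] {𝒰 : SubgroupTower G} (κ : G →* ℤ_[p]ˣ)

/-- `x⁻¹ ≡ 1 mod p^n ↔ x ≡ 1 mod p^n` for a unit `x ∈ ℤ_pˣ` (the congruence cells are inversion-stable). [cite: deShalit1987, I.3.3 (9) (p. 18)] -/
theorem toZModPow_units_inv_eq_one_iff (n : ℕ) (x : ℤ_[p]ˣ) :
    PadicInt.toZModPow n ((x⁻¹ : ℤ_[p]ˣ) : ℤ_[p]) = 1 ↔ PadicInt.toZModPow n (x : ℤ_[p]) = 1 := by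
  have hmul : PadicInt.toZModPow n ((x⁻¹ : ℤ_[p]ˣ) : ℤ_[p]) * PadicInt.toZModPow n (x : ℤ_[p]) = 1 := by
    rw [← map_mul, Units.inv_mul, map_one]
  constructor
  · intro h; rwa [h, one_mul] at hmul
  · intro h; rwa [h, mul_one] at hmul

/-- ★ **`hU` for `κ⁻¹` from `hU` for `κ`**: the tower is cut out by `κ⁻¹ ≡ 1` iff by `κ ≡ 1`. [cite: deShalit1987, I.3.3 (9) (p. 18), II.1.9 (p. 42)] -/
theorem subgroupTower_hU_inv
    (hU : ∀ (n : ℕ) (g : G), g ∈ 𝒰.U n ↔ g ∈ 𝒰.U 0 ∧ PadicInt.toZModPow (n + 1) (κ g : ℤ_[p]) = 1) :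
    ∀ (n : ℕ) (g : G), g ∈ 𝒰.U n ↔ g ∈ 𝒰.U 0 ∧ PadicInt.toZModPow (n + 1) (κ⁻¹ g : ℤ_[p]) = 1 := by
  intro n g
  rw [hU n g, MonoidHom.inv_apply, toZModPow_units_inv_eq_one_iff]

/-- ★ **`hκ` for `κ⁻¹` from `hκ` for `κ`** (apply `hκ` to `w⁻¹`). [cite: deShalit1987, I.3.3 (9) (p. 18), II.1.7 (p. 41)] -/
theorem subgroupTower_hκ_inv
    (hκ : ∀ (n : ℕ) (w : ℤ_[p]ˣ), PadicInt.toZModPow 1 (w : ℤ_[p]) = 1 →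
      ∃ g ∈ 𝒰.U 0, PadicInt.toZModPow (n + 1) (κ g : ℤ_[p]) = PadicInt.toZModPow (n + 1) (w : ℤ_[p])) :
    ∀ (n : ℕ) (w : ℤ_[p]ˣ), PadicInt.toZModPow 1 (w : ℤ_[p]) = 1 →
      ∃ g ∈ 𝒰.U 0, PadicInt.toZModPow (n + 1) (κ⁻¹ g : ℤ_[p]) = PadicInt.toZModPow (n + 1) (w : ℤ_[p]) := by
  intro n w hw1
  have hw1' : PadicInt.toZModPow 1 ((w⁻¹ : ℤ_[p]ˣ) : ℤ_[p]) = 1 := (toZModPow_units_inv_eq_one_iff 1 w).mpr hw1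
  obtain ⟨g, hg, hgw⟩ := hκ n w⁻¹ hw1'
  refine ⟨g, hg, ?_⟩
  have hw' : PadicInt.toZModPow (n + 1) ((w⁻¹ : ℤ_[p]ˣ) : ℤ_[p]) * PadicInt.toZModPow (n + 1) (w : ℤ_[p]) = 1 := by
    rw [← map_mul, Units.inv_mul, map_one]
  have hg' : PadicInt.toZModPow (n + 1) (((κ g)⁻¹ : ℤ_[p]ˣ) : ℤ_[p]) *
      PadicInt.toZModPow (n + 1) ((κ g : ℤ_[p]ˣ) : ℤ_[p]) = 1 := by
    rw [← map_mul, Units.inv_mul, map_one]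
  rw [MonoidHom.inv_apply]
  calc PadicInt.toZModPow (n + 1) (((κ g)⁻¹ : ℤ_[p]ˣ) : ℤ_[p])
      = PadicInt.toZModPow (n + 1) (((κ g)⁻¹ : ℤ_[p]ˣ) : ℤ_[p]) *
          (PadicInt.toZModPow (n + 1) ((w⁻¹ : ℤ_[p]ˣ) : ℤ_[p]) * PadicInt.toZModPow (n + 1) (w : ℤ_[p])) := by
        rw [hw', mul_one]
    _ = PadicInt.toZModPow (n + 1) (((κ g)⁻¹ : ℤ_[p]ˣ) : ℤ_[p]) * PadicInt.toZModPow (n + 1) ((κ g : ℤ_[p]ˣ) : ℤ_[p]) *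
          PadicInt.toZModPow (n + 1) (w : ℤ_[p]) := by rw [← hgw, mul_assoc]
    _ = PadicInt.toZModPow (n + 1) (w : ℤ_[p]) := by rw [hg', one_mul]

end Inversion

/-! ### §2. `hη` and `hgal` of the relative series family from the `κ_v`-dictionary -/

section Supply

open NumberField IsDedekindDomain IsDedekindDomain.HeightOneSpectrum Field ValuativeRel IsLocalRing
open Literature.NumberTheory.GaloisRepresentations Literature.NumberTheory.GaloisRepresentations.IsNonarchimedeanLocalField
  Literature.NumberTheory.GaloisRepresentations.LubinTate Literature.NumberTheory.PAdicHodge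
  Literature.NumberTheory.GaloisRepresentations.ArtinLocalGlobal Literature.NumberTheory.NumberFields

variable {K : Type} [Field K] [NumberField K] [IsTotallyComplex K] {𝔪 : Ideal (𝓞 K)} {v : HeightOneSpectrum (𝓞 K)}
  (h𝔪 : 𝔪 ≠ ⊥) (hv : ¬ 𝔪 ≤ v.asIdeal) (hw : ∀ u : (𝓞 K)ˣ, (u : 𝓞 K) - 1 ∈ 𝔪 → u = 1)

attribute [local instance] ltNormUniformSpace ltNormIsUniformAddGroup rk1 nF nE fintypeResidueField

variable (h2 : (valuation (v.adicCompletion K)).IsUniformizer (((2 : ℕ) : 𝒪[v.adicCompletion K]) : v.adicCompletion K))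
  (u : 𝒪[v.adicCompletion K]ˣ)
  (E : IntermediateField (v.adicCompletion K) (AlgebraicClosure (v.adicCompletion K)))
  [FiniteDimensional (v.adicCompletion K) E] [Normal (v.adicCompletion K) E] [IsGalois (v.adicCompletion K) E]
  (hq : residueFieldCard (v.adicCompletion K) = 2) (hE : E ≤ maxUnramified (v.adicCompletion K))
  {σ₀ : absoluteGaloisGroup (v.adicCompletion K)} (hσ₀ : IsAbsArithFrob σ₀) (uL : LTCoeff (v.adicCompletion K))
  (j : unitBall E →+* UnrCoeff (v.adicCompletion K))
  (hj : j.comp (algebraMap (LTCoeff (v.adicCompletion K)) (unitBall E)) =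
    (intToUnrCoeff (v.adicCompletion K)).comp (LTCoeff.of (v.adicCompletion K)).symm.toRingHom)
  (e : 𝒪[v.adicCompletion K] →+* ℤ_[2])
  {𝒰 : SubgroupTower ↥(absRestrictNormalHom (rayClassField K 𝔪)).ker}
  (κ : ↥(absRestrictNormalHom (rayClassField K 𝔪)).ker →* ℤ_[2]ˣ)
  (hκ : ∀ g, κ g = (Units.map ((e.comp (integerEquivAdicCompletionIntegers v).symm.toRingHom :
      v.adicCompletionIntegers K →+* ℤ_[2]) : v.adicCompletionIntegers K →* ℤ_[2]) (rayAdicCharacter h𝔪 hv hw g))⁻¹)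
  {B : Type*} [CommMonoid B] [MulDistribMulAction ↥(absRestrictNormalHom (rayClassField K 𝔪)).ker B]
  (η : B → RelNormCoherentUnits (isUniformizer_unit_mul h2 u) E)
  (hdict : ∀ g ∈ 𝒰.U 0, ∀ b : B, ∀ (w : WeilGroup (v.adicCompletion K))
      (hwI : w ∈ WeilGroup.inertia (v.adicCompletion K)),
      rayAdicCharacter h𝔪 hv hw ⟨absGaloisRestrict K (v.adicCompletion K)
          (WeilGroup.toAbsGalois (v.adicCompletion K) w),
        absGaloisRestrict_toAbsGalois_mem_ker_rayClassField h𝔪 hv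
          (isLocalArtinMap_canonicalArtin_holds (v.adicCompletion K)) hwI⟩ = rayAdicCharacter h𝔪 hv hw g →
      η (g • b) = (η b).galAct (WeilGroup.toAbsGalois (v.adicCompletion K) w))

omit [IsGalois (v.adicCompletion K) E] in
include hE hκ hdict in
/-- ★ **`hdict ⟹ hη`**: for `g ∈ U_0` take an inertia element `w` with `κ_v(res w) = κ_v g`
(`exists_mem_inertia_rayAdicCharacter_eq`); `σ̃ := toAbsGalois w` fixes `E` (`smul_coe_eq_of_mem_inertia`), acts on `η b` as
`g` (the dictionary), and `e(χ_π σ̃) = κ g` (`unitsMap_lubinTateChar_eq_inv_of_rayAdicCharacter_eq`).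
[cite: deShalit1987, II.1.10 Corollary (p. 39), II.4.5–4.6 (p. 58–59), I.3.4 Lemma (ii) (p. 18)] -/
theorem seriesFamily_hη_of_dictionary :
    ∀ g ∈ 𝒰.U 0, ∀ b : B, ∃ σ : absoluteGaloisGroup (v.adicCompletion K),
      (∀ x : E, σ • (x : AlgebraicClosure (v.adicCompletion K)) = x) ∧
      η (g • b) = (η b).galAct σ ∧
      Units.map (e : 𝒪[v.adicCompletion K] →* ℤ_[2]) (lubinTateChar (isUniformizer_unit_mul h2 u) σ) = κ g := by
  intro g hg b
  obtain ⟨w, hwI, hκw⟩ := exists_mem_inertia_rayAdicCharacter_eq h𝔪 hv hw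
    (isLocalArtinMap_canonicalArtin_holds (v.adicCompletion K)) g
  refine ⟨WeilGroup.toAbsGalois (v.adicCompletion K) w, fun x ↦ smul_coe_eq_of_mem_inertia v hwI hE x,
    hdict g hg b w hwI hκw, ?_⟩
  rw [hκ g]
  exact unitsMap_lubinTateChar_eq_inv_of_rayAdicCharacter_eq h𝔪 hv hw (isUniformizer_unit_mul h2 u) e g hwI hκw

include hE hκ hdict hj in
/-- ★ **`hdict ⟹ hgal` VERBATIM** for the relative series family `φ b := j((δ_E g_{η b})~)` and the character
`κ = ((e ∘ §1⁻¹) ∘ κ_v)⁻¹` (through `seriesFamily_hgal_of_relNormCoherentUnits`).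
[cite: deShalit1987, I.3.4 Lemma (ii) (p. 18), II.4.6 (14) (p. 59), II.1.10 Corollary (p. 39)] -/
theorem seriesFamily_hgal_of_dictionary :
    ∀ g ∈ 𝒰.U 0, ∀ b : B, ∃ a : 𝒪[v.adicCompletion K], (κ g : ℤ_[2]) = e a ∧
      (relTildeSeries (isUniformizer_unit_mul h2 u) E hq hE hσ₀ uL (η (g • b))).map j =
        PowerSeries.C (intToUnrCoeff (v.adicCompletion K) a) * PowerSeries.subst (homC' h2 u a)
          ((relTildeSeries (isUniformizer_unit_mul h2 u) E hq hE hσ₀ uL (η b)).map j) :=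
  seriesFamily_hgal_of_relNormCoherentUnits h2 u E hq hE hσ₀ uL j hj κ e η
    (seriesFamily_hη_of_dictionary h𝔪 hv hw h2 u E hE e κ hκ η hdict)

end Supply

/-! ### §3. The inverted character on the GLOBAL ray tower: `hU` / `hκ` VERBATIM and the `hκ` identity -/

section Tower

open NumberField IsDedekindDomain IsDedekindDomain.HeightOneSpectrum Field ValuativeRel
open Literature.NumberTheory.GaloisRepresentations Literature.NumberTheory.NumberFields

variable {K : Type} [Field K] [NumberField K] [IsTotallyComplex K] {𝔪 𝔪' : Ideal (𝓞 K)} {v : HeightOneSpectrum (𝓞 K)}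
  (h𝔪' : 𝔪' ≠ ⊥) (h𝔪 : 𝔪 ≠ ⊥) (hv : ¬ 𝔪 ≤ v.asIdeal) (hw : ∀ u : (𝓞 K)ˣ, (u : 𝓞 K) - 1 ∈ 𝔪 → u = 1)
  {p : ℕ} [Fact p.Prime] (e₂ : v.adicCompletionIntegers K ≃+* ℤ_[p]) (hle : 𝔪' ≤ 𝔪) (hv' : ¬ 𝔪' ≤ v.asIdeal)

include hle hv' in
/-- ★ **`hU` VERBATIM for `(rayAdicTower, κ_p⁻¹)`** (g8's `mem_rayAdicTower_iff` through `subgroupTower_hU_inv`).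
[cite: deShalit1987, II.1.9 (p. 43), II.4.6 (p. 59)] -/
theorem mem_rayAdicTower_iff_inv (n : ℕ) (σ : ↥(absRestrictNormalHom (rayClassField K 𝔪)).ker) :
    σ ∈ (rayAdicTower (𝔪 := 𝔪) h𝔪' v).U n ↔ σ ∈ (rayAdicTower (𝔪 := 𝔪) h𝔪' v).U 0 ∧
      PadicInt.toZModPow (n + 1)
        ((((Units.map (e₂ : v.adicCompletionIntegers K →+* ℤ_[p]).toMonoidHom).comp
          (rayAdicCharacter h𝔪 hv hw))⁻¹ σ : ℤ_[p]ˣ) : ℤ_[p]) = 1 :=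
  subgroupTower_hU_inv _ (mem_rayAdicTower_iff h𝔪' h𝔪 hv hw e₂ hle hv') n σ

include hle hv' in
/-- ★ **`hκ` VERBATIM for `(rayAdicTower, κ_p⁻¹)`** (g8's `exists_toZModPow_padicRayAdicCharacter_eq` through
`subgroupTower_hκ_inv`). [cite: deShalit1987, I.3.3 (9) (p. 18), II.1.7 (p. 41)] -/
theorem exists_toZModPow_padicRayAdicCharacter_inv_eq (n : ℕ) (u : ℤ_[p]ˣ) (hu : PadicInt.toZModPow 1 (u : ℤ_[p]) = 1) :
    ∃ σ ∈ (rayAdicTower (𝔪 := 𝔪) h𝔪' v).U 0, PadicInt.toZModPow (n + 1)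
        ((((Units.map (e₂ : v.adicCompletionIntegers K →+* ℤ_[p]).toMonoidHom).comp
          (rayAdicCharacter h𝔪 hv hw))⁻¹ σ : ℤ_[p]ˣ) : ℤ_[p]) = PadicInt.toZModPow (n + 1) (u : ℤ_[p]) :=
  subgroupTower_hκ_inv _ (exists_toZModPow_padicRayAdicCharacter_eq h𝔪' h𝔪 hv hw e₂ hle hv') n u hu

/-- **The `hκ` identity**: with `e := e₂ ∘ §1 : 𝒪[K_v] →+* ℤ_[p]` (`§1 = integerEquivAdicCompletionIntegers v`),
`κ_p⁻¹ g = ((e ∘ §1⁻¹)(κ_v g))⁻¹` — the hypothesis `hκ` of `seriesFamily_hη_of_dictionary` for `κ := κ_p⁻¹`.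
[cite: deShalit1987, I.3.3 (9) (p. 18)] -/
theorem padicRayAdicCharacter_inv_apply (g : ↥(absRestrictNormalHom (rayClassField K 𝔪)).ker) :
    ((Units.map (e₂ : v.adicCompletionIntegers K →+* ℤ_[p]).toMonoidHom).comp (rayAdicCharacter h𝔪 hv hw))⁻¹ g =
      (Units.map ((((e₂ : v.adicCompletionIntegers K →+* ℤ_[p]).comp
            (integerEquivAdicCompletionIntegers v).toRingHom).comp
            (integerEquivAdicCompletionIntegers v).symm.toRingHom : v.adicCompletionIntegers K →+* ℤ_[p]) :
          v.adicCompletionIntegers K →* ℤ_[p]) (rayAdicCharacter h𝔪 hv hw g))⁻¹ := by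
  rw [MonoidHom.inv_apply, MonoidHom.comp_apply]
  -- the two `Units.map`s agree: `§1 (§1⁻¹ x) = x` definitionally (both maps are the identity on `K_v`)
  congr 1

end Tower

end Literature.NumberTheory.EllipticCurves

end
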